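import Literature.Computability.Complexity.SelectBricks
import Literature.Computability.Complexity.BrickAlgebra
import Literature.Computability.Complexity.FPStringBricks
import Literature.Computability.Complexity.NSubexp
import HarnessLib

/-!
# The `MCSP` table machine, I: one step down a hybrid GGM tree is in `FP` (proofs)

Part of the proof architecture of the named fact `AllenderEtAl2006_MCSP_universalInverter`
(`MCSPUniversalInverter.lean`; Allender–Buhrman–Koucký–van Melkebeek–Ronneburger 2006, Thm. 45
with §4.2): the first brick of the polynomial-time string function writing the truth table of a
hybrid of the GGM tree (hypothesis `hTab` of `mcsp_universalInverter_of_hill_of_tables`,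
`MCSPUniversalInverterReduction.lean`). The machine walks from the root to leaf `t`, one level
per round of a counted loop (`Brick.loopFn_mem_FP`); this file supplies the loop BODY as an `FP`
function with its semantics (`exists_walkBody`), in the brick algebra of `BrickAlgebra.lean`.

The loop record is `⟨X, ⟨counter, L⟩⟩` with the environment
`X = ⟨y, ⟨z, ⟨ρ', ⟨1^ℓ, ⟨bin k, ⟨bin i, bin t⟩⟩⟩⟩⟩⟩` (parameter, challenge, table of fresh
labels, block length, depth, step number, leaf number) and the current label `L ∈ {0,1}^ℓ`; in
the round with counter `c + 1` (depth `e = k − c − 1` reached so far) the body replaces `L` by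
the label one level down (rule of `distLab`, `MetaComplexity/GGM.lean`; arithmetic form in
`MCSPTreeWalk.lean`): with node number `n = 2ᵉ − 1 + ⌊t / 2^{c+1}⌋` and step bit
`b = ⌊t / 2ᶜ⌋ mod 2`, the fresh label `ρ'[ℓ(2n+b), +ℓ)` if `n < i`, the half `z[ℓb, +ℓ)` of the
challenge if `n = i`, and the half `G ⟨y, L⟩[ℓb, +ℓ)` otherwise. All three are chunks
(`chunkF`, `SelectBricks.lean`); the arithmetic is on binary numerals (`addFn`, `subFn`, `divFn`,
`remFn`, `ltFn`, powers of two by `powFn 1` of unary numerals obtained by `binToUnaryFn` with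
the long ruler `ρ'`).

Theorems only (the body is a `let` of the proof, exported existentially with its two properties:
a length bound valid on every input, and its value on well-formed records).

## References

* E. Allender et al., *Power from random strings*, SIAM J. Comput. 35(6) (2006)
  [AllenderEtAl2006]: proof of Thm. 45 (p. 24).
* A. A. Razborov, S. Rudich, *Natural proofs*, JCSS 55 (1997) [RazborovRudich1997]: proof of
  Thm. 4.1.
* S. Arora, B. Barak, *Computational Complexity: A Modern Approach*, CUP 2009 [AroraBarak2009]:
  §1.3 (polynomial time is closed under composition and bounded loops), proof of Thm. 9.17.
-/

namespace Literature.Computability.MetaComplexity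

open _root_.Computability Complexity Complexity.Brick Complexity.TimeConstructible

/-- The chunk brick never outputs more than the block-length field. [folklore] -/
private theorem length_chunkF_le (a b c d : List Bool) :
    (chunkF (boolPair a (boolPair b (boolPair c d)))).length ≤ b.length := by
  simp [chunkF]

/-- `1ᵐ` is the unary numeral. [folklore] -/
private theorem ones_eq_unaryEncodeNat (m : ℕ) : ones m = unaryEncodeNat m :=
  (OracleCompose.unaryEncodeNat_eq_replicate m).symm

/-- `powFn 1 (1ᵐ) = bin 2ᵐ`. [folklore] -/
private theorem powFn_one_ones (m : ℕ) : powFn 1 (ones m) = encodeNat (2 ^ m) := by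
  rw [ones_eq_unaryEncodeNat, powFn_unary, pow_one]

/-- The node number of an ancestor of a leaf is a node number: `2^{k−c−1} − 1 + ⌊t/2^{c+1}⌋ < 2ᵏ`.
[folklore] -/
private theorem nodeNumber_lt {k c t : ℕ} (hck : c + 1 ≤ k) (ht : t < 2 ^ k) :
    2 ^ (k - c - 1) - 1 + t / 2 ^ (c + 1) < 2 ^ k := by
  have h3 : t / 2 ^ (c + 1) < 2 ^ (k - (c + 1)) := by
    rw [Nat.div_lt_iff_lt_mul (Nat.two_pow_pos _), ← pow_add]
    have e : k - (c + 1) + (c + 1) = k := by omega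
    rwa [e]
  have h4 : 2 ^ (k - (c + 1)) * 2 ≤ 2 ^ k := by
    rw [← pow_succ]
    exact Nat.pow_le_pow_right (by norm_num) (by omega)
  have e : k - c - 1 = k - (c + 1) := by omega
  rw [e]
  have : 1 ≤ 2 ^ (k - (c + 1)) := Nat.one_le_two_pow
  omega

/-- A block number fits under the ruler: `2n + b < 2^{k+1}` for `n < 2ᵏ`, `b ≤ 1`. [folklore] -/
private theorem blockNumber_lt {k n b : ℕ} (hn : n < 2 ^ k) (hb : b ≤ 1) : 2 * n + b < 2 ^ (k + 1) := by
  rw [pow_succ]; omega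

/-- **The body of the walk loop is in `FP`, with its semantics.** For `G ∈ FP` there is a string
function `body ∈ FP` such that (i) on every input `w`, `|body w| ≤ |field 3 of field 0 of w|`
(the block-length field; this is the growth bound of `Brick.loopFn_mem_FP`), and (ii) on a
well-formed loop record `⟨X, ⟨bin (c+1), L⟩⟩`,
`X = ⟨y, ⟨z, ⟨ρ', ⟨1^ℓ, ⟨bin k, ⟨bin i, bin t⟩⟩⟩⟩⟩⟩` with `c + 1 ≤ k ≤ |ρ'|`,
`2^{k+1} ≤ |ρ'|`, `|z| = 2ℓ`, `|G ⟨y, L⟩| = 2ℓ`, `1 ≤ ℓ`, `t < 2ᵏ`, `i < 2ᵏ`, the value is the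
label one level down: with `n = 2^{k−c−1} − 1 + ⌊t/2^{c+1}⌋` and `b = ⌊t/2ᶜ⌋ mod 2`, it is
`(ρ'.drop (ℓ(2n+b))).take ℓ` if `n < i`, `(z.drop (ℓ b)).take ℓ` if `n = i`, and
`((G ⟨y, L⟩).drop (ℓ b)).take ℓ` otherwise. [cite: AroraBarak2009, §1.3 and proof of Thm. 9.17 p. 228]
[cite: AllenderEtAl2006, Thm. 45 (proof, p. 24)] -/
theorem exists_walkBody {G : List Bool → List Bool} (hG : G ∈ FP) :
    ∃ body : List Bool → List Bool, body ∈ FP ∧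
      (∀ w : List Bool, (body w).length ≤ (nthF 3 (nthF 0 w)).length) ∧
      ∀ (y z ρ' L : List Bool) (ℓ k i t c : ℕ),
        c + 1 ≤ k → k ≤ ρ'.length → 2 ^ (k + 1) ≤ ρ'.length → z.length = 2 * ℓ →
        (G (boolPair y L)).length = 2 * ℓ → 1 ≤ ℓ → t < 2 ^ k → i < 2 ^ k →
        body (boolPair
            (boolPair y (boolPair z (boolPair ρ' (boolPair (ones ℓ)
              (boolPair (encodeNat k) (boolPair (encodeNat i) (encodeNat t)))))))
            (boolPair (encodeNat (c + 1)) L)) =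
          if 2 ^ (k - c - 1) - 1 + t / 2 ^ (c + 1) < i then
            (ρ'.drop (ℓ * (2 * (2 ^ (k - c - 1) - 1 + t / 2 ^ (c + 1)) + t / 2 ^ c % 2))).take ℓ
          else if 2 ^ (k - c - 1) - 1 + t / 2 ^ (c + 1) = i then
            (z.drop (ℓ * (t / 2 ^ c % 2))).take ℓ
          else ((G (boolPair y L)).drop (ℓ * (t / 2 ^ c % 2))).take ℓ := by
  -- accessors of the loop record `⟨X, ⟨cnt, L⟩⟩`
  let aX : List Bool → List Bool := nthF 0
  let acnt : List Bool → List Bool := nthF 1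
  let aL : List Bool → List Bool := sndPow 1
  let ay : List Bool → List Bool := nthF 0 ∘ aX
  let az : List Bool → List Bool := nthF 1 ∘ aX
  let aρ : List Bool → List Bool := nthF 2 ∘ aX
  let aℓ : List Bool → List Bool := nthF 3 ∘ aX
  let ak : List Bool → List Bool := nthF 4 ∘ aX
  let ai : List Bool → List Bool := nthF 5 ∘ aX
  let atF : List Bool → List Bool := sndPow 5 ∘ aX
  let one : List Bool → List Bool := fun _ => encodeNat 1
  let two : List Bool → List Bool := fun _ => encodeNat 2
  -- unary numerals `1^{k-(c+1)}`, `1^{c+1}`, `1^c` (ruler `ρ'`) and the powers of two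
  let eU : List Bool → List Bool := binToUnaryFn ∘ fanoutFn aρ (subFn ∘ fanoutFn ak acnt)
  let p2e : List Bool → List Bool := powFn 1 ∘ eU
  let cU : List Bool → List Bool := binToUnaryFn ∘ fanoutFn aρ acnt
  let p2c : List Bool → List Bool := powFn 1 ∘ cU
  let cmU : List Bool → List Bool := binToUnaryFn ∘ fanoutFn aρ (subFn ∘ fanoutFn acnt one)
  let p2cm : List Bool → List Bool := powFn 1 ∘ cmU
  -- node number `n`, step bit `b`, block number `2n + b`
  let nF : List Bool → List Bool :=
    addFn ∘ fanoutFn (subFn ∘ fanoutFn p2e one) (divFn ∘ fanoutFn atF p2c)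
  let bF : List Bool → List Bool := remFn ∘ fanoutFn (divFn ∘ fanoutFn atF p2cm) two
  let qF : List Bool → List Bool := addFn ∘ fanoutFn (addFn ∘ fanoutFn nF nF) bF
  -- the three candidate labels
  let blockA : List Bool → List Bool := chunkF ∘ fanoutFn aρ (fanoutFn aℓ (fanoutFn qF aρ))
  let blockB : List Bool → List Bool := chunkF ∘ fanoutFn az (fanoutFn aℓ (fanoutFn bF az))
  let wF : List Bool → List Bool := G ∘ fanoutFn ay aL
  let blockC : List Bool → List Bool := chunkF ∘ fanoutFn wF (fanoutFn aℓ (fanoutFn bF wF))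
  -- the conditions `n < i`, `n = i`
  let c1 : List Bool → List Bool := ltFn ∘ fanoutFn nF ai
  let c2 : List Bool → List Bool :=
    andFn (notFn (ltFn ∘ fanoutFn nF ai)) (notFn (ltFn ∘ fanoutFn ai nF))
  let body : List Bool → List Bool := iteFn c1 blockA (iteFn c2 blockB blockC)
  -- membership in `FP`
  have haX : aX ∈ FP := nthF_mem_FP 0
  have hacnt : acnt ∈ FP := nthF_mem_FP 1
  have haL : aL ∈ FP := sndPow_mem_FP 1
  have hay : ay ∈ FP := comp_mem_FP (nthF_mem_FP 0) haX
  have haz : az ∈ FP := comp_mem_FP (nthF_mem_FP 1) haX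
  have haρ : aρ ∈ FP := comp_mem_FP (nthF_mem_FP 2) haX
  have haℓ : aℓ ∈ FP := comp_mem_FP (nthF_mem_FP 3) haX
  have hak : ak ∈ FP := comp_mem_FP (nthF_mem_FP 4) haX
  have hai : ai ∈ FP := comp_mem_FP (nthF_mem_FP 5) haX
  have hat : atF ∈ FP := comp_mem_FP (sndPow_mem_FP 5) haX
  have hone : one ∈ FP := const_mem_FP _
  have htwo : two ∈ FP := const_mem_FP _
  have heU : eU ∈ FP := comp_mem_FP binToUnaryFn_mem_FP
    (fanoutFn_mem_FP haρ (comp_mem_FP subFn_mem_FP (fanoutFn_mem_FP hak hacnt)))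
  have hp2e : p2e ∈ FP := comp_mem_FP (powFn_mem_FP 1) heU
  have hcU : cU ∈ FP := comp_mem_FP binToUnaryFn_mem_FP (fanoutFn_mem_FP haρ hacnt)
  have hp2c : p2c ∈ FP := comp_mem_FP (powFn_mem_FP 1) hcU
  have hcmU : cmU ∈ FP := comp_mem_FP binToUnaryFn_mem_FP
    (fanoutFn_mem_FP haρ (comp_mem_FP subFn_mem_FP (fanoutFn_mem_FP hacnt hone)))
  have hp2cm : p2cm ∈ FP := comp_mem_FP (powFn_mem_FP 1) hcmU
  have hnF : nF ∈ FP := comp_mem_FP addFn_mem_FP (fanoutFn_mem_FP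
    (comp_mem_FP subFn_mem_FP (fanoutFn_mem_FP hp2e hone))
    (comp_mem_FP divFn_mem_FP (fanoutFn_mem_FP hat hp2c)))
  have hbF : bF ∈ FP := comp_mem_FP remFn_mem_FP (fanoutFn_mem_FP
    (comp_mem_FP divFn_mem_FP (fanoutFn_mem_FP hat hp2cm)) htwo)
  have hqF : qF ∈ FP := comp_mem_FP addFn_mem_FP (fanoutFn_mem_FP
    (comp_mem_FP addFn_mem_FP (fanoutFn_mem_FP hnF hnF)) hbF)
  have hblockA : blockA ∈ FP := comp_mem_FP chunkF_mem_FP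
    (fanoutFn_mem_FP haρ (fanoutFn_mem_FP haℓ (fanoutFn_mem_FP hqF haρ)))
  have hblockB : blockB ∈ FP := comp_mem_FP chunkF_mem_FP
    (fanoutFn_mem_FP haz (fanoutFn_mem_FP haℓ (fanoutFn_mem_FP hbF haz)))
  have hwF : wF ∈ FP := comp_mem_FP hG (fanoutFn_mem_FP hay haL)
  have hblockC : blockC ∈ FP := comp_mem_FP chunkF_mem_FP
    (fanoutFn_mem_FP hwF (fanoutFn_mem_FP haℓ (fanoutFn_mem_FP hbF hwF)))
  have hc1 : c1 ∈ FP := comp_mem_FP ltFn_mem_FP (fanoutFn_mem_FP hnF hai)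
  have hc2 : c2 ∈ FP := andFn_mem_FP (notFn_mem_FP (comp_mem_FP ltFn_mem_FP (fanoutFn_mem_FP hnF hai)))
    (notFn_mem_FP (comp_mem_FP ltFn_mem_FP (fanoutFn_mem_FP hai hnF)))
  have hbody : body ∈ FP := iteFn_mem_FP hc1 hblockA (iteFn_mem_FP hc2 hblockB hblockC)
  -- one-bit conditions
  have h1bit : OneBit c1 := oneBit_ltFn.comp _
  have h2bit : OneBit c2 := oneBit_andFn (oneBit_notFn (oneBit_ltFn.comp _))
    (oneBit_notFn (oneBit_ltFn.comp _))
  refine ⟨body, hbody, fun w => ?_, ?_⟩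
  · -- (i) the length bound, on every input
    have hA : (blockA w).length ≤ (nthF 3 (nthF 0 w)).length := by
      simp only [blockA, Function.comp_apply, fanoutFn_apply]
      exact length_chunkF_le _ _ _ _
    have hB : (blockB w).length ≤ (nthF 3 (nthF 0 w)).length := by
      simp only [blockB, Function.comp_apply, fanoutFn_apply]
      exact length_chunkF_le _ _ _ _
    have hC : (blockC w).length ≤ (nthF 3 (nthF 0 w)).length := by
      simp only [blockC, Function.comp_apply, fanoutFn_apply]
      exact length_chunkF_le _ _ _ _
    show (iteFn c1 blockA (iteFn c2 blockB blockC) w).length ≤ _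
    rw [iteFn_of_oneBit h1bit]
    split_ifs
    · exact hA
    · rw [iteFn_of_oneBit h2bit]
      split_ifs
      · exact hB
      · exact hC
  · -- (ii) the value on a well-formed record
    intro y z ρ' L ℓ k i t c hck hkρ hρ hz hGL hℓ ht hi
    set X := boolPair y (boolPair z (boolPair ρ' (boolPair (ones ℓ)
      (boolPair (encodeNat k) (boolPair (encodeNat i) (encodeNat t)))))) with hX
    set R := boolPair X (boolPair (encodeNat (c + 1)) L) with hR
    -- sizes (pure arithmetic, from the private lemmas)
    have hn_lt : 2 ^ (k - c - 1) - 1 + t / 2 ^ (c + 1) < 2 ^ k := nodeNumber_lt hck ht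
    have hb_le : t / 2 ^ c % 2 ≤ 1 := Nat.le_of_lt_succ (Nat.mod_lt _ Nat.two_pos)
    have hq_le : 2 * (2 ^ (k - c - 1) - 1 + t / 2 ^ (c + 1)) + t / 2 ^ c % 2 ≤ ρ'.length :=
      ((blockNumber_lt hn_lt hb_le).le).trans hρ
    have hkc : k - (c + 1) ≤ ρ'.length := (Nat.sub_le _ _).trans hkρ
    have hc1 : c + 1 ≤ ρ'.length := hck.trans hkρ
    have hc0 : c ≤ ρ'.length := (Nat.le_succ c).trans hc1
    have hz1 : t / 2 ^ c % 2 ≤ z.length :=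
      hb_le.trans (by rw [hz]; exact hℓ.trans (Nat.le_mul_of_pos_left ℓ Nat.two_pos))
    have hw1 : t / 2 ^ c % 2 ≤ (G (boolPair y L)).length := by rw [hGL, ← hz]; exact hz1
    -- field values
    have vX : aX R = X := by simp [aX, hR]
    have vcnt : acnt R = encodeNat (c + 1) := by simp [acnt, hR]
    have vL : aL R = L := by simp [aL, hR]
    have vy : ay R = y := by simp [ay, aX, hR, hX]
    have vz : az R = z := by simp [az, aX, hR, hX]
    have vρ : aρ R = ρ' := by simp [aρ, aX, hR, hX]
    have vℓ : aℓ R = ones ℓ := by simp [aℓ, aX, hR, hX]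
    have vk : ak R = encodeNat k := by simp [ak, aX, hR, hX]
    have vi : ai R = encodeNat i := by simp [ai, aX, hR, hX]
    have vt : atF R = encodeNat t := by simp [atF, aX, hR, hX]
    -- unary numerals and powers of two
    have veU : eU R = ones (k - (c + 1)) := by
      simp only [eU, Function.comp_apply, fanoutFn_apply, vρ, vk, vcnt, subFn_boolPair,
        bitsToNat_encodeNat, binToUnaryFn_boolPair]
      rw [min_eq_left hkc]
    have vp2e : p2e R = encodeNat (2 ^ (k - c - 1)) := by
      simp only [p2e, Function.comp_apply, veU, powFn_one_ones]
      rw [show k - (c + 1) = k - c - 1 from (Nat.sub_sub k c 1).symm]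
    have vcU : cU R = ones (c + 1) := by
      simp only [cU, Function.comp_apply, fanoutFn_apply, vρ, vcnt, bitsToNat_encodeNat,
        binToUnaryFn_boolPair]
      rw [min_eq_left hc1]
    have vp2c : p2c R = encodeNat (2 ^ (c + 1)) := by
      simp only [p2c, Function.comp_apply, vcU, powFn_one_ones]
    have vcmU : cmU R = ones c := by
      simp only [cmU, Function.comp_apply, fanoutFn_apply, vρ, vcnt, one, subFn_boolPair,
        bitsToNat_encodeNat, binToUnaryFn_boolPair]
      rw [show c + 1 - 1 = c from rfl, min_eq_left hc0]
    have vp2cm : p2cm R = encodeNat (2 ^ c) := by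
      simp only [p2cm, Function.comp_apply, vcmU, powFn_one_ones]
    -- node number, step bit, block number (named only as abbreviations of the statement)
    generalize hn : 2 ^ (k - c - 1) - 1 + t / 2 ^ (c + 1) = n at hn_lt hq_le ⊢
    generalize hb : t / 2 ^ c % 2 = b at hb_le hq_le hz1 hw1 ⊢
    have vn : nF R = encodeNat n := by
      simp only [nF, Function.comp_apply, fanoutFn_apply, vp2e, one, vt, vp2c, subFn_boolPair,
        divFn_boolPair, addFn_boolPair, bitsToNat_encodeNat, hn]
    have vb : bF R = encodeNat b := by
      simp only [bF, Function.comp_apply, fanoutFn_apply, vt, vp2cm, two, divFn_boolPair,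
        remFn_boolPair, bitsToNat_encodeNat, hb]
    have vq : qF R = encodeNat (2 * n + b) := by
      simp only [qF, Function.comp_apply, fanoutFn_apply, vn, vb, addFn_boolPair,
        bitsToNat_encodeNat]
      rw [two_mul]
    -- the three blocks
    have vA : blockA R = (ρ'.drop (ℓ * (2 * n + b))).take ℓ := by
      simp only [blockA, Function.comp_apply, fanoutFn_apply, vρ, vℓ, vq]
      rw [chunkF_apply, bitsToNat_encodeNat, min_eq_left hq_le]
    have vB : blockB R = (z.drop (ℓ * b)).take ℓ := by
      simp only [blockB, Function.comp_apply, fanoutFn_apply, vz, vℓ, vb]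
      rw [chunkF_apply, bitsToNat_encodeNat, min_eq_left hz1]
    have vw : wF R = G (boolPair y L) := by
      simp only [wF, Function.comp_apply, fanoutFn_apply, vy, vL]
    have vC : blockC R = ((G (boolPair y L)).drop (ℓ * b)).take ℓ := by
      simp only [blockC, Function.comp_apply, fanoutFn_apply, vw, vℓ, vb]
      rw [chunkF_apply, bitsToNat_encodeNat, min_eq_left hw1]
    -- the conditions
    have vc1 : c1 R = [decide (n < i)] := by
      simp only [c1, Function.comp_apply, fanoutFn_apply, vn, vi, ltFn_boolPair,
        bitsToNat_encodeNat]
    have vc2 : c2 R = [decide (n = i)] := by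
      have h1 : (ltFn ∘ fanoutFn nF ai) R = [decide (n < i)] := vc1
      have h2 : (ltFn ∘ fanoutFn ai nF) R = [decide (i < n)] := by
        simp only [Function.comp_apply, fanoutFn_apply, vn, vi, ltFn_boolPair,
          bitsToNat_encodeNat]
      simp only [c2]
      rw [andFn_apply (notFn_apply h1) (notFn_apply h2)]
      rcases Nat.lt_trichotomy n i with h | h | h
      · simp [h, Nat.ne_of_lt h]
      · subst h; simp
      · simp [h, Nat.ne_of_gt h, Nat.lt_asymm h]
    -- assemble
    show iteFn c1 blockA (iteFn c2 blockB blockC) R = _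
    rw [iteFn_apply vc1]
    by_cases hlt : n < i
    · rw [if_pos hlt, decide_eq_true hlt, if_pos rfl, vA]
    · rw [if_neg hlt, decide_eq_false hlt, if_neg Bool.false_ne_true, iteFn_apply vc2]
      by_cases heq : n = i
      · rw [if_pos heq, decide_eq_true heq, if_pos rfl, vB]
      · rw [if_neg heq, decide_eq_false heq, if_neg Bool.false_ne_true, vC]

end Literature.Computability.MetaComplexity
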